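/-
Copyright: public-audit package `pub-balaban` (b2b-balaban), seat pv09-g4. Released under Apache 2.0 like Mathlib.
-/
import Literature.MathematicalPhysics.QuantumFieldTheory.Balaban1983to89.B6LayerRayleigh

/-!
# B6, p. 245: in d = 2 the printed layer sentence holds EXACTLY for L ≤ 9

Source under audit: T. Bałaban, *Propagators and renormalization transformations for lattice gauge theories.
II*, Commun. Math. Phys. **96** (1984) 223–250 [B6], proof of Lemma 2.4, p. 245.  Companion of
`B6Lemma24Kappa` (`LayerIneq d L κ`), `B6LayerUpperBound` (κ ≤ 12/(L + 1)) and `B6LayerRayleigh`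
(¬ `LayerIneq d L 1` for every L ≥ 10, d ≥ 2).

## The printed sentence (verbatim, p. 245, between (2.126) and (2.127))

*"The terms in parentheses on the right-hand side can be written as L^{−2}⟨B, (Δ_{Δ′}^{L^{−1},N} +
Q′*_{Δ′}Q′_{Δ′})B⟩, where the operators are defined on a d − 1-dimensional lattice.  This quadratic form is
bounded from below by L^{−d−1} Σ_{x∈Δ′} |B_μ(x)|², hence"* [(2.127) follows].  (Same quotation as in
`B6LayerPoincare`, `B6LayerUpperBound`, `B6LayerRayleigh`.)  The sentence is `LayerIneq d L 1`.

## What this file proves (all [folklore]; nothing printed is asserted or used)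

In d = 2 the face Δ′ is a segment of L sites and the "d − 1-dimensional lattice" operator is the path P_L, so the
layer inequality can be decided completely:

* `layerIneq_two_iff` — for L ≥ 1 and every κ: `LayerIneq 2 L κ ↔ PathIneq L κ`, where
  `PathIneq L κ := ∀ u : ℤ → ℝ, κ Σ_{0≤a<L} u(a)² ≤ L Σ_{a+1<L} (u(a+1) − u(a))² + (Σ_{0≤a<L} u(a))²/L`
  (parametrisation a ↦ `linePt L y μ a` of Δ′ for EVERY corner y and direction μ: `sum_lastLayer_two`,
  `gradSq_lastLayer_two`).
* `pathIneq_one_1`, …, `pathIneq_one_9` — `PathIneq L 1` for L = 1, …, 9, by EXACT RATIONAL SUM-OF-SQUARES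
  certificates: the quadratic form L²Σ(u(a+1) − u(a))² − LΣu(a)² + (Σu(a))² is the Gram form of the integer LDLᵀ
  rows listed in the proofs (e.g. for L = 9: (73, −80, 1, …, 1), (538, −640, 17, …, 17), …), and `linarith` finds the
  (positive, rational) pivots; for L = 10 the form is indefinite (`B6LayerRayleigh.not_layerIneq_one_ten`).
* `layerIneq_len_zero` — `LayerIneq d 0 κ` for every d (the face is empty).
* `layerIneq_two_one_iff` — **`LayerIneq 2 L 1 ↔ L ≤ 9`** for every L : ℕ (← by the certificates, → by
  `B6LayerRayleigh.not_layerIneq_one_of_ten_le`).  This is the kernel's first POSITIVE instance of the printed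
  factor 1 (the admissible constants certified so far, κ₀ and κ₁, are < 1), and it shows that the threshold
  "L ≥ 10" of the census claim G-B6-09 is exact.

## HONEST SCOPE

d = 2 only on the positive side: for d ≥ 3 the positive statement (factor 1 for L ≤ 9) needs the tensorisation of
the one-dimensional Neumann–Poincaré inequality over the d − 1 free coordinates of Δ′ and is NOT formalised.
Nothing here concerns the constant of Lemma 2.4 (2.128) itself (printed 1/(12d²): numerically supported, unproved,
G-B6-09R).  No printed statement is asserted; `LayerIneq` is B6Lemma24Kappa's free-constant reading of the sentence.
-/

namespace Literature.MathematicalPhysics.QuantumFieldTheory.Balaban1983to89.B6LayerDimTwo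

open Finset
open B6Elimination (block mem_block)
open B6BondElimination (unitVec unitVec_apply add_unitVec_apply)
open B6FaceInterpolation (lastLayer bondsIn mem_lastLayer mem_bondsIn)
open B6LayerPoincare (gradSq)
open B6Lemma24Kappa (LayerIneq)
open B6LayerUpperBound (sum_Ico_int_eq_sum_range)
open B6LayerRayleigh (not_layerIneq_one_of_ten_le)

variable {L : ℕ}

/-! ## §1  The two indices of Fin 2 -/

/-- The other index. [folklore] -/
def other (μ : Fin 2) : Fin 2 := if μ = 0 then 1 else 0

/-- `other μ ≠ μ`. [folklore] -/
theorem other_ne (μ : Fin 2) : other μ ≠ μ := by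
  unfold other
  rcases Fin.exists_fin_two.mp ⟨μ, rfl⟩ with h | h <;> rw [h] <;> decide

/-- Every index is μ or the other one. [folklore] -/
theorem eq_or_eq_other (i μ : Fin 2) : i = μ ∨ i = other μ := by
  unfold other
  rcases Fin.exists_fin_two.mp ⟨μ, rfl⟩ with h | h <;>
    rcases Fin.exists_fin_two.mp ⟨i, rfl⟩ with h' | h' <;> rw [h, h'] <;> decide

/-! ## §2  Parametrisation of the face Δ′ in d = 2 -/

/-- The point of Δ′ = {x_μ = y_μ + L − 1} × [y_ν, y_ν + L) with free coordinate y_ν + a. [folklore] -/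
def linePt (L : ℕ) (y : Fin 2 → ℤ) (μ : Fin 2) (a : ℤ) : Fin 2 → ℤ :=
  fun i => if i = μ then y μ + (L : ℤ) - 1 else y i + a

/-- μ-coordinate of `linePt`. [folklore] -/
theorem linePt_apply_self (y : Fin 2 → ℤ) (μ : Fin 2) (a : ℤ) : linePt L y μ a μ = y μ + (L : ℤ) - 1 := by
  simp [linePt]

/-- ν-coordinate of `linePt`. [folklore] -/
theorem linePt_apply_other (y : Fin 2 → ℤ) (μ : Fin 2) (a : ℤ) :
    linePt L y μ a (other μ) = y (other μ) + a := by
  simp only [linePt, if_neg (other_ne μ)]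

/-- Membership in Δ′ in d = 2: the μ-coordinate is y_μ + L − 1 and the other one lies in [y_ν, y_ν + L). [folklore] -/
theorem mem_lastLayer_two {y x : Fin 2 → ℤ} {μ : Fin 2} :
    x ∈ lastLayer L y μ ↔ x μ = y μ + (L : ℤ) - 1 ∧ y (other μ) ≤ x (other μ) ∧ x (other μ) < y (other μ) + L := by
  rw [mem_lastLayer, mem_block]
  constructor
  · rintro ⟨hb, hμ⟩
    exact ⟨hμ, (hb (other μ)).1, (hb (other μ)).2⟩
  · rintro ⟨hμ, h1, h2⟩
    refine ⟨fun i => ?_, hμ⟩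
    rcases eq_or_eq_other i μ with rfl | rfl
    · constructor <;> omega
    · exact ⟨h1, h2⟩

/-- `linePt a ∈ Δ′` for 0 ≤ a < L. [folklore] -/
theorem linePt_mem (y : Fin 2 → ℤ) (μ : Fin 2) {a : ℤ} (ha : a ∈ Ico (0 : ℤ) L) : linePt L y μ a ∈ lastLayer L y μ := by
  rw [mem_Ico] at ha
  rw [mem_lastLayer_two, linePt_apply_self, linePt_apply_other]
  exact ⟨rfl, by omega, by omega⟩

/-- Every x ∈ Δ′ is `linePt (x_ν − y_ν)`. [folklore] -/
theorem linePt_eq_of_mem {y x : Fin 2 → ℤ} {μ : Fin 2} (hx : x ∈ lastLayer L y μ) :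
    linePt L y μ (x (other μ) - y (other μ)) = x := by
  rw [mem_lastLayer_two] at hx
  funext i
  rcases eq_or_eq_other i μ with rfl | rfl
  · rw [linePt_apply_self, hx.1]
  · rw [linePt_apply_other]; ring

/-- **Sums over Δ′ in d = 2 are sums over the segment [0, L).** [folklore] -/
theorem sum_lastLayer_two (y : Fin 2 → ℤ) (μ : Fin 2) (F : (Fin 2 → ℤ) → ℝ) :
    ∑ x ∈ lastLayer L y μ, F x = ∑ a ∈ Ico (0 : ℤ) L, F (linePt L y μ a) := by
  refine sum_nbij' (fun x => x (other μ) - y (other μ)) (fun a => linePt L y μ a) ?_ ?_ ?_ ?_ ?_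
  · intro x hx
    rw [mem_lastLayer_two] at hx
    rw [mem_Ico]; constructor <;> omega
  · intro a ha
    exact linePt_mem y μ ha
  · intro x hx
    exact linePt_eq_of_mem hx
  · intro a _
    simp only [linePt_apply_other]; ring
  · intro x hx
    rw [linePt_eq_of_mem hx]

/-- In d = 2 no bond of direction μ lies inside Δ′ (the μ-coordinate is frozen). [folklore] -/
theorem snd_eq_other_of_mem_bondsIn {y : Fin 2 → ℤ} {μ : Fin 2} {b : (Fin 2 → ℤ) × Fin 2}
    (hb : b ∈ bondsIn (lastLayer L y μ)) : b.2 = other μ := by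
  rcases eq_or_eq_other b.2 μ with h | h
  · exfalso
    rw [mem_bondsIn, mem_lastLayer_two, mem_lastLayer_two, add_unitVec_apply, h, if_pos rfl] at hb
    omega
  · exact h

/-- x + e_ν stays in Δ′ iff x_ν + 1 < y_ν + L (x ∈ Δ′). [folklore] -/
theorem add_unitVec_mem_iff {y x : Fin 2 → ℤ} {μ : Fin 2} (hx : x ∈ lastLayer L y μ) :
    x + unitVec (other μ) ∈ lastLayer L y μ ↔ x (other μ) + 1 < y (other μ) + L := by
  rw [mem_lastLayer_two] at hx ⊢
  rw [add_unitVec_apply, add_unitVec_apply, if_pos rfl, if_neg (other_ne μ).symm]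
  constructor
  · rintro ⟨-, -, h⟩; omega
  · intro h; exact ⟨by omega, by omega, h⟩

/-- `linePt a + e_ν = linePt (a + 1)`. [folklore] -/
theorem linePt_add_unitVec (y : Fin 2 → ℤ) (μ : Fin 2) (a : ℤ) :
    linePt L y μ a + unitVec (other μ) = linePt L y μ (a + 1) := by
  funext i
  rw [add_unitVec_apply]
  rcases eq_or_eq_other i μ with rfl | rfl
  · rw [linePt_apply_self, linePt_apply_self, if_neg (other_ne _).symm, add_zero]
  · rw [linePt_apply_other, linePt_apply_other, if_pos rfl]; ring

/-- **The gradient form on Δ′ in d = 2 is the path energy of the profile a ↦ g(linePt a).** [folklore] -/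
theorem gradSq_lastLayer_two (y : Fin 2 → ℤ) (μ : Fin 2) (g : (Fin 2 → ℤ) → ℝ) :
    gradSq g (lastLayer L y μ) =
      ∑ a ∈ Ico (0 : ℤ) L, (if a + 1 < (L : ℤ) then (g (linePt L y μ (a + 1)) - g (linePt L y μ a)) ^ 2 else 0) := by
  classical
  set Δ := lastLayer L y μ with hΔ
  set w : (Fin 2 → ℤ) → ℝ := fun x => (g (x + unitVec (other μ)) - g x) ^ 2 with hw
  have h1 : gradSq g Δ = ∑ b ∈ bondsIn Δ, (if b.2 = other μ then w b.1 else 0) := by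
    unfold gradSq
    refine sum_congr rfl fun b hb => ?_
    have hb2 : b.2 = other μ := snd_eq_other_of_mem_bondsIn hb
    rw [if_pos hb2, hw]
    simp only
    rw [← hb2]
  have h2 : ∑ b ∈ bondsIn Δ, (if b.2 = other μ then w b.1 else 0) =
      ∑ x ∈ Δ.filter (fun x => x + unitVec (other μ) ∈ Δ), w x := by
    rw [← sum_filter]
    refine sum_nbij' (fun b => b.1) (fun x => (x, other μ)) ?_ ?_ ?_ ?_ ?_
    · intro b hb
      rw [mem_filter, mem_bondsIn] at hb
      rw [mem_filter]
      obtain ⟨⟨h1b, h2b⟩, h3b⟩ := hb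
      rw [h3b] at h2b
      exact ⟨h1b, h2b⟩
    · intro x hx
      rw [mem_filter] at hx
      rw [mem_filter, mem_bondsIn]
      exact ⟨⟨hx.1, hx.2⟩, rfl⟩
    · intro b hb
      rw [mem_filter] at hb
      exact Prod.ext rfl hb.2.symm
    · intro x _; rfl
    · intro b _; rfl
  have h3 : ∑ x ∈ Δ.filter (fun x => x + unitVec (other μ) ∈ Δ), w x =
      ∑ x ∈ Δ, (if x (other μ) + 1 < y (other μ) + (L : ℤ) then w x else 0) := by
    rw [sum_filter]
    refine sum_congr rfl fun x hx => ?_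
    by_cases h : x (other μ) + 1 < y (other μ) + (L : ℤ)
    · rw [if_pos h, if_pos ((add_unitVec_mem_iff hx).2 h)]
    · rw [if_neg h, if_neg (fun h' => h ((add_unitVec_mem_iff hx).1 h'))]
  rw [h1, h2, h3, hΔ, sum_lastLayer_two]
  refine sum_congr rfl fun a _ => ?_
  rw [linePt_apply_other]
  by_cases h : a + 1 < (L : ℤ)
  · rw [if_pos h, if_pos (by omega), hw]
    simp only
    rw [linePt_add_unitVec]
  · rw [if_neg h, if_neg (by omega)]

/-! ## §3  The layer inequality in d = 2 is the path inequality -/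

/-- The path inequality with constant κ: κ Σu² ≤ L Σ(u(a+1) − u(a))² + (Σu)²/L on [0, L). [folklore] -/
def PathIneq (L : ℕ) (κ : ℝ) : Prop :=
  ∀ u : ℤ → ℝ, κ * ∑ a ∈ Ico (0 : ℤ) L, u a ^ 2 ≤
    (L : ℝ) * ∑ a ∈ Ico (0 : ℤ) L, (if a + 1 < (L : ℤ) then (u (a + 1) - u a) ^ 2 else 0) +
      (∑ a ∈ Ico (0 : ℤ) L, u a) ^ 2 / (L : ℝ)

/-- Clearing the powers of L (d = 2: L^{−3}, L^{−2}, L^{−1}). [folklore] -/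
theorem scaled_iff (hL : 1 ≤ L) (κ S D T : ℝ) :
    κ * ((L : ℝ)⁻¹) ^ (2 + 1) * S ≤ ((L : ℝ)⁻¹) ^ 2 * D + ((L : ℝ)⁻¹) ^ 2 * (((L : ℝ)⁻¹) ^ (2 - 1) * T) ^ 2 ↔
      κ * S ≤ (L : ℝ) * D + T ^ 2 / (L : ℝ) := by
  have hL0 : (0 : ℝ) < L := by exact_mod_cast hL
  have hL1 : (L : ℝ) ≠ 0 := hL0.ne'
  have e1 : κ * ((L : ℝ)⁻¹) ^ (2 + 1) * S = (κ * S) / (L : ℝ) ^ 3 := by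
    rw [show (2 + 1 : ℕ) = 3 from rfl, inv_pow, div_eq_mul_inv]; ring
  have e2 : ((L : ℝ)⁻¹) ^ 2 * D + ((L : ℝ)⁻¹) ^ 2 * (((L : ℝ)⁻¹) ^ (2 - 1) * T) ^ 2 =
      ((L : ℝ) * D + T ^ 2 / (L : ℝ)) / (L : ℝ) ^ 3 := by
    rw [show (2 - 1 : ℕ) = 1 from rfl, pow_one, eq_div_iff (by positivity)]
    simp only [inv_pow]
    field_simp
  rw [e1, e2, div_le_div_iff_of_pos_right (by positivity)]

/-- **In d = 2 the layer inequality IS the path inequality** (every corner y, every direction μ). [folklore] -/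
theorem layerIneq_two_iff (hL : 1 ≤ L) (κ : ℝ) : LayerIneq 2 L κ ↔ PathIneq L κ := by
  constructor
  · intro h u
    set μ : Fin 2 := 0 with hμ
    have key := h 0 μ (fun x => u (x (other μ)))
    rw [sum_lastLayer_two, sum_lastLayer_two, gradSq_lastLayer_two] at key
    simp only [linePt_apply_other, Pi.zero_apply, zero_add] at key
    exact (scaled_iff hL κ _ _ _).1 key
  · intro h y μ g
    have key := h (fun a => g (linePt L y μ a))
    rw [sum_lastLayer_two, sum_lastLayer_two, gradSq_lastLayer_two]
    exact (scaled_iff hL κ _ _ _).2 key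

/-! ## §4  Exact sum-of-squares certificates: `PathIneq L 1` for L = 1, …, 9 -/

/-- L = 1: u(0)² ≤ 0 + u(0)². [folklore] -/
theorem pathIneq_one_1 : PathIneq 1 1 := by
  intro u
  rw [sum_Ico_int_eq_sum_range 1, sum_Ico_int_eq_sum_range 1, sum_Ico_int_eq_sum_range 1]
  simp only [sum_range_succ, sum_range_zero]
  push_cast
  norm_num

/-- L = 2: the form 2²Σ(u(a+1) − u(a))² − 2Σu(a)² + (Σu(a))² is the Gram form of the 1 integer rows below with positive
rational weights (exact LDLᵀ), found by `linarith`. [folklore] -/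
theorem pathIneq_one_2 : PathIneq 2 1 := by
  intro u
  rw [sum_Ico_int_eq_sum_range 2, sum_Ico_int_eq_sum_range 2, sum_Ico_int_eq_sum_range 2]
  simp only [sum_range_succ, sum_range_zero]
  push_cast
  norm_num
  linarith [sq_nonneg (u 0 - u 1)]

/-- L = 3: the form 3²Σ(u(a+1) − u(a))² − 3Σu(a)² + (Σu(a))² is the Gram form of the 2 integer rows below with positive
rational weights (exact LDLᵀ), found by `linarith`. [folklore] -/
theorem pathIneq_one_3 : PathIneq 3 1 := by
  intro u
  rw [sum_Ico_int_eq_sum_range 3, sum_Ico_int_eq_sum_range 3, sum_Ico_int_eq_sum_range 3]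
  simp only [sum_range_succ, sum_range_zero]
  push_cast
  norm_num
  linarith [sq_nonneg (7 * u 0 - 8 * u 1 + u 2),
    sq_nonneg (u 1 - u 2)]

/-- L = 4: the form 4²Σ(u(a+1) − u(a))² − 4Σu(a)² + (Σu(a))² is the Gram form of the 3 integer rows below with positive
rational weights (exact LDLᵀ), found by `linarith`. [folklore] -/
theorem pathIneq_one_4 : PathIneq 4 1 := by
  intro u
  rw [sum_Ico_int_eq_sum_range 4, sum_Ico_int_eq_sum_range 4, sum_Ico_int_eq_sum_range 4]
  simp only [sum_range_succ, sum_range_zero]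
  push_cast
  norm_num
  linarith [sq_nonneg (13 * u 0 - 15 * u 1 + u 2 + u 3),
    sq_nonneg (38 * u 1 - 45 * u 2 + 7 * u 3),
    sq_nonneg (u 2 - u 3)]

/-- L = 5: the form 5²Σ(u(a+1) − u(a))² − 5Σu(a)² + (Σu(a))² is the Gram form of the 4 integer rows below with positive
rational weights (exact LDLᵀ), found by `linarith`. [folklore] -/
theorem pathIneq_one_5 : PathIneq 5 1 := by
  intro u
  rw [sum_Ico_int_eq_sum_range 5, sum_Ico_int_eq_sum_range 5, sum_Ico_int_eq_sum_range 5]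
  simp only [sum_range_succ, sum_range_zero]
  push_cast
  norm_num
  linarith [sq_nonneg (21 * u 0 - 24 * u 1 + u 2 + u 3 + u 4),
    sq_nonneg (26 * u 1 - 32 * u 2 + 3 * u 3 + 3 * u 4),
    sq_nonneg (139 * u 2 - 167 * u 3 + 28 * u 4),
    sq_nonneg (u 3 - u 4)]

/-- L = 6: the form 6²Σ(u(a+1) − u(a))² − 6Σu(a)² + (Σu(a))² is the Gram form of the 5 integer rows below with positive
rational weights (exact LDLᵀ), found by `linarith`. [folklore] -/
theorem pathIneq_one_6 : PathIneq 6 1 := by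
  intro u
  rw [sum_Ico_int_eq_sum_range 6, sum_Ico_int_eq_sum_range 6, sum_Ico_int_eq_sum_range 6]
  simp only [sum_range_succ, sum_range_zero]
  push_cast
  norm_num
  linarith [sq_nonneg (31 * u 0 - 35 * u 1 + u 2 + u 3 + u 4 + u 5),
    sq_nonneg (142 * u 1 - 175 * u 2 + 11 * u 3 + 11 * u 4 + 11 * u 5),
    sq_nonneg (597 * u 2 - 767 * u 3 + 85 * u 4 + 85 * u 5),
    sq_nonneg (2504 * u 3 - 3043 * u 4 + 539 * u 5),
    sq_nonneg (u 4 - u 5)]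

/-- L = 7: the form 7²Σ(u(a+1) − u(a))² − 7Σu(a)² + (Σu(a))² is the Gram form of the 6 integer rows below with positive
rational weights (exact LDLᵀ), found by `linarith`. [folklore] -/
theorem pathIneq_one_7 : PathIneq 7 1 := by
  intro u
  rw [sum_Ico_int_eq_sum_range 7, sum_Ico_int_eq_sum_range 7, sum_Ico_int_eq_sum_range 7]
  simp only [sum_range_succ, sum_range_zero]
  push_cast
  norm_num
  linarith [sq_nonneg (43 * u 0 - 48 * u 1 + u 2 + u 3 + u 4 + u 5 + u 6),
    sq_nonneg (236 * u 1 - 288 * u 2 + 13 * u 3 + 13 * u 4 + 13 * u 5 + 13 * u 6),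
    sq_nonneg (293 * u 2 - 383 * u 3 + 30 * u 4 + 30 * u 5 + 30 * u 6),
    sq_nonneg (5435 * u 3 - 7281 * u 4 + 923 * u 5 + 923 * u 6),
    sq_nonneg (25807 * u 4 - 31926 * u 5 + 6119 * u 6),
    sq_nonneg (u 5 - u 6)]

/-- L = 8: the form 8²Σ(u(a+1) − u(a))² − 8Σu(a)² + (Σu(a))² is the Gram form of the 7 integer rows below with positive
rational weights (exact LDLᵀ), found by `linarith`. [folklore] -/
theorem pathIneq_one_8 : PathIneq 8 1 := by
  intro u
  rw [sum_Ico_int_eq_sum_range 8, sum_Ico_int_eq_sum_range 8, sum_Ico_int_eq_sum_range 8]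
  simp only [sum_range_succ, sum_range_zero]
  push_cast
  norm_num
  linarith [sq_nonneg (57 * u 0 - 63 * u 1 + u 2 + u 3 + u 4 + u 5 + u 6 + u 7),
    sq_nonneg (122 * u 1 - 147 * u 2 + 5 * u 3 + 5 * u 4 + 5 * u 5 + 5 * u 6 + 5 * u 7),
    sq_nonneg (2123 * u 2 - 2767 * u 3 + 161 * u 4 + 161 * u 5 + 161 * u 6 + 161 * u 7),
    sq_nonneg (11164 * u 3 - 15529 * u 4 + 1455 * u 5 + 1455 * u 6 + 1455 * u 7),
    sq_nonneg (54749 * u 4 - 77791 * u 5 + 11521 * u 6 + 11521 * u 7),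
    sq_nonneg (278602 * u 5 - 358297 * u 6 + 79695 * u 7),
    sq_nonneg (u 6 - u 7)]

/-- L = 9: the form 9²Σ(u(a+1) − u(a))² − 9Σu(a)² + (Σu(a))² is the Gram form of the 8 integer rows below with positive
rational weights (exact LDLᵀ), found by `linarith`. [folklore] -/
theorem pathIneq_one_9 : PathIneq 9 1 := by
  intro u
  rw [sum_Ico_int_eq_sum_range 9, sum_Ico_int_eq_sum_range 9, sum_Ico_int_eq_sum_range 9]
  simp only [sum_range_succ, sum_range_zero]
  push_cast
  norm_num
  linarith [sq_nonneg (73 * u 0 - 80 * u 1 + u 2 + u 3 + u 4 + u 5 + u 6 + u 7 + u 8),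
    sq_nonneg (538 * u 1 - 640 * u 2 + 17 * u 3 + 17 * u 4 + 17 * u 5 + 17 * u 6 + 17 * u 7 + 17 * u 8),
    sq_nonneg (1797 * u 2 - 2317 * u 3 + 104 * u 4 + 104 * u 5 + 104 * u 6 + 104 * u 7 + 104 * u 8),
    sq_nonneg (21551 * u 3 - 30187 * u 4 + 2159 * u 5 + 2159 * u 6 + 2159 * u 7 + 2159 * u 8),
    sq_nonneg (114539 * u 4 - 174104 * u 5 + 19855 * u 6 + 19855 * u 7 + 19855 * u 8),
    sq_nonneg (542883 * u 5 - 868195 * u 6 + 162656 * u 7 + 162656 * u 8),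
    sq_nonneg (2572153 * u 6 - 3729050 * u 7 + 1156897 * u 8),
    sq_nonneg (u 7 - u 8)]

/-! ## §5  The empty face and the dichotomy -/

/-- For L = 0 the face is empty and the layer inequality is trivial (any d, any κ). [folklore] -/
theorem layerIneq_len_zero {d : ℕ} (κ : ℝ) : LayerIneq d 0 κ := by
  intro y μ g
  have hempty : lastLayer 0 y μ = ∅ := by
    ext x
    simp only [notMem_empty, iff_false]
    intro hx
    rw [mem_lastLayer, mem_block] at hx
    have := hx.1 μ
    omega
  have hb : bondsIn (∅ : Finset (Fin d → ℤ)) = ∅ := by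
    ext b; simp [mem_bondsIn]
  rw [hempty]
  unfold gradSq
  rw [hb]
  simp

/-- **In d = 2 the printed layer sentence (factor 1) holds EXACTLY for L ≤ 9.** [folklore] -/
theorem layerIneq_two_one_iff : LayerIneq 2 L 1 ↔ L ≤ 9 := by
  constructor
  · intro h
    by_contra hL
    exact not_layerIneq_one_of_ten_le (d := 2) le_rfl (by omega) h
  · intro hL
    rcases Nat.eq_zero_or_pos L with rfl | hpos
    · exact layerIneq_len_zero (d := 2) 1
    · rw [layerIneq_two_iff hpos]
      interval_cases L
      · exact pathIneq_one_1
      · exact pathIneq_one_2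
      · exact pathIneq_one_3
      · exact pathIneq_one_4
      · exact pathIneq_one_5
      · exact pathIneq_one_6
      · exact pathIneq_one_7
      · exact pathIneq_one_8
      · exact pathIneq_one_9

/-- Hence in d = 2: `LayerIneq 2 L κ` for every κ ≤ 1 when L ≤ 9. [folklore] -/
theorem layerIneq_two_of_le_one (hL : L ≤ 9) {κ : ℝ} (hκ : κ ≤ 1) : LayerIneq 2 L κ :=
  (layerIneq_two_one_iff.2 hL).mono hκ

end Literature.MathematicalPhysics.QuantumFieldTheory.Balaban1983to89.B6LayerDimTwo
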